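import Literature.Geometry.Riemannian.ColdingMinicozziEntropyLowerBound
import Literature.Geometry.Riemannian.GaussianAreaDistortionUpper
import Literature.Geometry.Riemannian.GaussianAreaEstimates
import Literature.MeasureTheory.Hausdorff.SmoothImageHausdorffFinite
import HarnessLib

/-!
# Gaussian densities of a closed embedded submanifold: `F_{x₀,t}(Σ) → 1` (`x₀ ∈ Σ`), `→ 0` (`x₀ ∉ Σ`)

Colding–Minicozzi 2012, Lemma 7.2 (3): "For each `x₀`, `lim_{t₀ → 0} F_{x₀,t₀}(Σ)` is `1` if
`x₀ ∈ Σ` and is `0` otherwise", for `Σ = f(M)` the image of a compact manifold `M` (boundaryless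
model of dimension `n`) under an injective `C^m` map `f` (`m ≥ 1`) into a real inner product
space, with the Gaussian area `F_{p,t} = gaussianArea n p t` of `ColdingMinicozziEntropy.lean`
(`𝓗ⁿ = μHE[n]`):

* `tendsto_gaussianArea_range_nhdsGT_zero` — at `f x₀`, where `df(x₀)` is injective:
  `F_{f x₀, t}(Σ) → 1` as `t → 0⁺`;
* `tendsto_gaussianArea_range_of_notMem` — at `y₀ ∉ Σ`: `F_{y₀, t}(Σ) → 0`.

Together with `ColdingMinicozziEntropyFinite.lean` (Lemma 7.2 (4): `λ(Σ) < ∞`) and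
`ColdingMinicozziEntropyLowerBound.lean` (`1 ≤ λ(Σ)`), this formalises the elementary part of
Colding–Minicozzi's Lemma 7.2 for closed embedded `C¹` submanifolds. Ingredients: the far-part
estimate `gaussianArea_le_of_le_norm_sub` / `tendsto_farFactor` of `GaussianAreaEstimates.lean`
(the part of `Σ` at distance `≥ δ` from the centre contributes
`≤ (4πt)^{-n/2} e^{-δ²/4t} μHE[n](Σ) → 0`) and, proved here,
`exists_ball_inter_range_subset_image` (an injective continuous map of a compact space is a
closed embedding, so a neighbourhood of `x₀` covers `Σ` near `f x₀`).

Everything is proved; no definitions and no named facts are introduced.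

## References

* T. H. Colding, W. P. Minicozzi II, *Generic mean curvature flow I; generic singularities*,
  Ann. of Math. 175 (2012) 755–833, Lemma 7.2 (3) and its proof. [ColdingMinicozzi2012]
-/

noncomputable section

open Set Function Filter Module Metric
open _root_.MeasureTheory _root_.MeasureTheory.Measure
open scoped ENNReal NNReal Topology Manifold

namespace Literature.Geometry.Riemannian

/-! ### Localisation for embeddings -/

section Localize

/-- **Localisation for embeddings of compact spaces**: if `f : M → F` is a continuous injection
of a compact space into a Hausdorff (pseudo)metric space and `V` is a neighbourhood of `x₀`,
then `f(V)` contains `range f ∩ ball (f x₀) δ` for some `δ > 0` (`f` is a closed embedding, so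
`V` contains the preimage of a neighbourhood of `f x₀`). [folklore] -/
theorem exists_ball_inter_range_subset_image {M F : Type*} [TopologicalSpace M] [CompactSpace M]
    [PseudoMetricSpace F] [T2Space F] {f : M → F} (hf : Continuous f) (hinj : Injective f)
    {x₀ : M} {V : Set M} (hV : V ∈ 𝓝 x₀) :
    ∃ δ : ℝ, 0 < δ ∧ range f ∩ ball (f x₀) δ ⊆ f '' V := by
  have hemb : Topology.IsClosedEmbedding f := hf.isClosedEmbedding hinj
  rw [hemb.isInducing.nhds_eq_comap] at hV
  obtain ⟨W, hW, hWV⟩ := hV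
  obtain ⟨δ, hδ, hballW⟩ := Metric.mem_nhds_iff.1 hW
  refine ⟨δ, hδ, ?_⟩
  rintro _ ⟨⟨x, rfl⟩, hx⟩
  exact ⟨x, hWV (hballW hx), rfl⟩

end Localize

/-! ### The limits -/

section Limit

variable {EM : Type*} [NormedAddCommGroup EM] [NormedSpace ℝ EM] [FiniteDimensional ℝ EM]
  {H : Type*} [TopologicalSpace H] {I : ModelWithCorners ℝ EM H} [I.Boundaryless]
  {M : Type*} [TopologicalSpace M] [ChartedSpace H M] [CompactSpace M]
  {F : Type*} [NormedAddCommGroup F] [InnerProductSpace ℝ F] [MeasurableSpace F] [BorelSpace F]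

/-- For `q < 1` there is `ε ∈ (0,1)` with `q < ((1-ε)/(1+ε))ⁿ` (continuity at `ε = 0`).
[folklore] -/
theorem exists_eps_ratio_pow_gt (n : ℕ) {q : ℝ} (hq : q < 1) :
    ∃ ε : ℝ, 0 < ε ∧ ε < 1 ∧ q < ((1 - ε) / (1 + ε)) ^ n := by
  have hcts : ContinuousAt (fun ε : ℝ => ((1 - ε) / (1 + ε)) ^ n) 0 :=
    ContinuousAt.pow (ContinuousAt.div (by fun_prop) (by fun_prop) (by norm_num)) n
  have h1 : ∀ᶠ ε : ℝ in 𝓝 0, q < ((1 - ε) / (1 + ε)) ^ n := by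
    have := hcts.tendsto
    simp only [sub_zero, add_zero, div_one, one_pow] at this
    exact this.eventually (lt_mem_nhds hq)
  have h2 : ∀ᶠ ε : ℝ in 𝓝[>] 0, q < ((1 - ε) / (1 + ε)) ^ n ∧ ε < 1 := by
    have h1' : ∀ᶠ ε : ℝ in 𝓝[>] 0, q < ((1 - ε) / (1 + ε)) ^ n := mem_nhdsWithin_of_mem_nhds h1
    have h3 : ∀ᶠ ε : ℝ in 𝓝[>] 0, ε < 1 := mem_nhdsWithin_of_mem_nhds (Iio_mem_nhds zero_lt_one)
    exact h1'.and h3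
  obtain ⟨ε, ⟨hq', hε1⟩, hε⟩ := (h2.and self_mem_nhdsWithin).exists
  exact ⟨ε, hε, hε1, hq'⟩

/-- For `b > 1` there is `ε ∈ (0,1)` with `((1+ε)/(1-ε))ⁿ < b` (continuity at `ε = 0`).
[folklore] -/
theorem exists_eps_ratio_pow_lt (n : ℕ) {b : ℝ} (hb : 1 < b) :
    ∃ ε : ℝ, 0 < ε ∧ ε < 1 ∧ ((1 + ε) / (1 - ε)) ^ n < b := by
  have hcts : ContinuousAt (fun ε : ℝ => ((1 + ε) / (1 - ε)) ^ n) 0 :=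
    ContinuousAt.pow (ContinuousAt.div (by fun_prop) (by fun_prop) (by norm_num)) n
  have h1 : ∀ᶠ ε : ℝ in 𝓝 0, ((1 + ε) / (1 - ε)) ^ n < b := by
    have := hcts.tendsto
    simp only [sub_zero, add_zero, div_one, one_pow] at this
    exact this.eventually (gt_mem_nhds hb)
  have h2 : ∀ᶠ ε : ℝ in 𝓝[>] 0, ((1 + ε) / (1 - ε)) ^ n < b ∧ ε < 1 := by
    have h1' : ∀ᶠ ε : ℝ in 𝓝[>] 0, ((1 + ε) / (1 - ε)) ^ n < b := mem_nhdsWithin_of_mem_nhds h1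
    have h3 : ∀ᶠ ε : ℝ in 𝓝[>] 0, ε < 1 := mem_nhdsWithin_of_mem_nhds (Iio_mem_nhds zero_lt_one)
    exact h1'.and h3
  obtain ⟨ε, ⟨hb', hε1⟩, hε⟩ := (h2.and self_mem_nhdsWithin).exists
  exact ⟨ε, hε, hε1, hb'⟩

omit [I.Boundaryless] in
/-- **Colding–Minicozzi 2012, Lemma 7.2 (3), the case `x₀ ∉ Σ`**: for a compact manifold `M`
and a `C^m` map `f : M → F` (`m ≥ 1`, model of dimension `n`), the Gaussian areas of
`Σ = f(M)` centred at a point `y₀ ∉ Σ` tend to `0` as the scale `t → 0⁺`: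
`F_{y₀,t}(Σ) ≤ (4πt)^{-n/2} e^{-δ²/4t} μHE[n](Σ)` with `δ = dist(y₀, Σ) > 0` and
`μHE[n](Σ) < ∞` (`Literature.MeasureTheory.Hausdorff.euclideanHausdorffMeasure_range_lt_top`).
[cite: ColdingMinicozzi2012, Lemma 7.2] -/
theorem tendsto_gaussianArea_range_of_notMem {n : ℕ} (hn : finrank ℝ EM = n) {f : M → F}
    {m : WithTop ℕ∞} (hf : ContMDiff I 𝓘(ℝ, F) m f) (hm : 1 ≤ m) {y₀ : F} (hy : y₀ ∉ range f) :
    Tendsto (fun t : ℝ => gaussianArea n y₀ t (range f)) (𝓝[>] 0) (𝓝 0) := by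
  have hK : IsCompact (range f) := isCompact_range hf.continuous
  have hΛ : (μHE[n] : Measure F) (range f) < ∞ :=
    MeasureTheory.Hausdorff.euclideanHausdorffMeasure_range_lt_top hf hm (hn ▸ le_rfl)
  -- a ball around `y₀` missing `range f`
  obtain ⟨δ, hδ, hball⟩ := Metric.mem_nhds_iff.1 (hK.isClosed.isOpen_compl.mem_nhds hy)
  have hfar : ∀ y ∈ range f, δ ≤ ‖y - y₀‖ := by
    intro y hy'
    by_contra hlt
    push Not at hlt
    exact hball (mem_ball_iff_norm.2 hlt) hy'
  have hbound : ∀ t : ℝ, 0 < t → gaussianArea n y₀ t (range f) ≤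
      ENNReal.ofReal ((4 * Real.pi * t) ^ (-(n : ℝ) / 2) * Real.exp (-δ ^ 2 / (4 * t))) *
        (μHE[n] : Measure F) (range f) := fun t ht =>
    gaussianArea_le_of_le_norm_sub n y₀ ht hK.isClosed.measurableSet hδ.le hfar
  have hlim : Tendsto (fun t : ℝ => ENNReal.ofReal ((4 * Real.pi * t) ^ (-(n : ℝ) / 2) *
      Real.exp (-δ ^ 2 / (4 * t))) * (μHE[n] : Measure F) (range f)) (𝓝[>] 0) (𝓝 0) := by
    have h1 := (ENNReal.tendsto_ofReal (tendsto_farFactor n hδ))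
    rw [ENNReal.ofReal_zero] at h1
    have h2 := ENNReal.Tendsto.mul_const h1 (Or.inr hΛ.ne)
    rwa [zero_mul] at h2
  refine tendsto_of_tendsto_of_tendsto_of_le_of_le' tendsto_const_nhds hlim
    (Eventually.of_forall fun t => bot_le) ?_
  filter_upwards [self_mem_nhdsWithin] with t ht
  exact hbound t ht

/-- **Colding–Minicozzi 2012, Lemma 7.2 (3), the case `x₀ ∈ Σ`: `F_{x₀,t₀}(Σ) → 1` as
`t₀ → 0`.** Let `M` be a compact manifold modelled (boundaryless) on an `n`-dimensional space,
`F` a real inner product space and `f : M → F` an injective `C^m` map (`m ≥ 1`) whose differential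
at `x₀` is injective (e.g. a `C¹` embedding of a closed manifold; only the point `x₀` needs an
injective differential). Then the Gaussian areas of `Σ = f(M)` centred at `f x₀` tend to `1` as
the scale tends to `0⁺`. "Property (3) is a standard consequence of the fact that smooth
hypersurfaces are approximated by a hyperplane on small scales (the function
`(4πt₀)^{-n/2} e^{-|x-x₀|²/4t₀}` is a heat kernel on a hyperplane through `x₀` and has integral one
on the hyperplane independent of `t₀`)." Formally: lower bound from
`one_le_mul_gaussianArea_image_add` (`ColdingMinicozziEntropyLowerBound.lean`); upper bound by
splitting `Σ` into `Σ ∩ B_δ(f x₀) ⊆ h(B_r)` — `h` the `(1 ± ε)`-bi-Lipschitz tangent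
reparametrisation of `exists_biLipschitz_tangent_reparam`, `δ` from
`exists_ball_inter_range_subset_image` (this is where injectivity of `f` enters) — whose Gaussian
area is `≤ ((1+ε)/(1-ε))ⁿ F^T_{0,·}(B_r) ≤ ((1+ε)/(1-ε))ⁿ` (`gaussianArea_image_le`,
`gaussianArea_zero_univ`), and the far part `Σ ∖ B_δ(f x₀)`, whose Gaussian area is
`≤ (4πt)^{-n/2}e^{-δ²/4t} μHE[n](Σ) → 0`. [cite: ColdingMinicozzi2012, Lemma 7.2] -/
theorem tendsto_gaussianArea_range_nhdsGT_zero {n : ℕ} (hn : finrank ℝ EM = n) {f : M → F}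
    {m : WithTop ℕ∞} (hf : ContMDiff I 𝓘(ℝ, F) m f) (hm : 1 ≤ m) (hinj : Injective f) (x₀ : M)
    (hd : Injective (mfderiv I 𝓘(ℝ, F) f x₀)) :
    Tendsto (fun t : ℝ => gaussianArea n (f x₀) t (range f)) (𝓝[>] 0) (𝓝 1) := by
  have hK : IsCompact (range f) := isCompact_range hf.continuous
  have hΛ : (μHE[n] : Measure F) (range f) < ∞ :=
    MeasureTheory.Hausdorff.euclideanHausdorffMeasure_range_lt_top hf hm (hn ▸ le_rfl)
  -- the chart representative at `x₀`
  set φ := extChartAt I x₀ with hφ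
  set g : EM → F := f ∘ φ.symm with hg
  have hfx : ContMDiffAt I 𝓘(ℝ, F) 1 f x₀ := (hf.of_le hm).contMDiffAt
  have hgd : ContDiffAt ℝ 1 g (φ x₀) := by
    have h := (contMDiffAt_iff.1 hfx).2
    rw [I.range_eq_univ, contDiffWithinAt_univ] at h
    exact h
  have hmd : MDifferentiableAt I 𝓘(ℝ, F) f x₀ := hfx.mdifferentiableAt one_ne_zero
  have hinj' : Injective (fderiv ℝ g (φ x₀)) := by
    have h := hd
    rw [hmd.mfderiv, I.range_eq_univ, fderivWithin_univ] at h
    exact h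
  have hstrict := hgd.hasStrictFDerivAt one_ne_zero
  have hg0 : g (φ x₀) = f x₀ := by
    simp only [hg, Function.comp_apply, hφ, extChartAt_to_inv]
  have hgrange : g '' univ ⊆ range f := by
    rintro _ ⟨u, -, rfl⟩
    exact ⟨_, rfl⟩
  rw [tendsto_order]
  constructor
  · -- lower bound
    intro a ha
    obtain ⟨q, hq0, haq, hq1⟩ := ENNReal.lt_iff_exists_real_btwn.1 ha
    rw [ENNReal.ofReal_lt_one] at hq1
    obtain ⟨ε, hε, hε1, hqε⟩ := exists_eps_ratio_pow_gt n hq1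
    have ha' : 0 < 1 + ε := by linarith
    have hc' : 0 < 1 - ε := by linarith
    set k : ℝ := ((1 + ε) / (1 - ε)) ^ n with hk
    have hkpos : 0 < k := by positivity
    have hkinv : k⁻¹ = ((1 - ε) / (1 + ε)) ^ n := by
      rw [hk, ← inv_pow, inv_div]
    obtain ⟨r, hr, hpt⟩ := one_le_mul_gaussianArea_image_add hn hstrict hinj' univ_mem hε hε1
    rw [hg0] at hpt
    -- choose `η > 0` with `(1 - η) / k > q`
    set η : ℝ := (1 - q * k) / 2 with hη
    have hqk : q * k < 1 := by
      rw [← lt_div_iff₀ hkpos, one_div, hkinv]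
      exact hqε
    have hηpos : 0 < η := by rw [hη]; linarith
    have hηq : q < (1 - η) / k := by
      rw [lt_div_iff₀ hkpos, hη]
      linarith
    -- the error term is eventually `≤ η` at the rescaled time `s / (1+ε)²`
    have herr : ∀ᶠ s : ℝ in 𝓝[>] 0,
        (2 : ℝ) ^ ((n : ℝ) / 2) * Real.exp (-r ^ 2 / (8 * (s / (1 + ε) ^ 2))) < η := by
      have h1 : Tendsto (fun s : ℝ => s / (1 + ε) ^ 2) (𝓝[>] 0) (𝓝[>] 0) := by
        refine tendsto_nhdsWithin_of_tendsto_nhds_of_eventually_within _ ?_ ?_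
        · have : Tendsto (fun s : ℝ => s / (1 + ε) ^ 2) (𝓝 0) (𝓝 (0 / (1 + ε) ^ 2)) :=
            tendsto_id.div_const _
          rw [zero_div] at this
          exact this.mono_left nhdsWithin_le_nhds
        · filter_upwards [self_mem_nhdsWithin] with s hs
          exact div_pos (mem_Ioi.1 hs) (by positivity)
      obtain ⟨t₀, ht₀, ht₀η⟩ := exists_pos_errTerm_le n hr hηpos
      -- monotonicity in `t`: `exp(-r²/(8t))` is increasing in `t`, so for `t ≤ t₀` the term is `≤` its value at `t₀`
      have hmono : ∀ t : ℝ, 0 < t → t ≤ t₀ →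
          (2 : ℝ) ^ ((n : ℝ) / 2) * Real.exp (-r ^ 2 / (8 * t)) ≤
            (2 : ℝ) ^ ((n : ℝ) / 2) * Real.exp (-r ^ 2 / (8 * t₀)) := by
        intro t ht htt
        refine mul_le_mul_of_nonneg_left (Real.exp_le_exp.2 ?_) (by positivity)
        rw [neg_div, neg_div, neg_le_neg_iff]
        exact div_le_div_of_nonneg_left (by positivity) (by positivity) (by linarith)
      have h2 : ∀ᶠ t : ℝ in 𝓝[>] 0, t ≤ t₀ := mem_nhdsWithin_of_mem_nhds (Iic_mem_nhds ht₀)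
      filter_upwards [h1.eventually (h2.and self_mem_nhdsWithin)] with s hs
      exact (hmono _ hs.2 hs.1).trans_lt ht₀η
    filter_upwards [herr, self_mem_nhdsWithin] with s hs hs0
    rw [mem_Ioi] at hs0
    have hsε : 0 < s / (1 + ε) ^ 2 := by positivity
    have h1 := hpt (s / (1 + ε) ^ 2) hsε
    rw [div_mul_cancel₀ s (by positivity : (1 + ε) ^ 2 ≠ 0)] at h1
    -- `1 ≤ k * F(g univ) + E` with `E < η`; and `F(g univ) ≤ F(range f)`
    have h2 : (1 : ℝ≥0∞) ≤ ENNReal.ofReal k * gaussianArea n (f x₀) s (range f) + ENNReal.ofReal η := by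
      refine h1.trans (add_le_add (mul_le_mul' le_rfl (gaussianArea_mono _ _ _ hgrange)) ?_)
      exact ENNReal.ofReal_le_ofReal hs.le
    by_cases htop : gaussianArea n (f x₀) s (range f) = ∞
    · rw [htop]
      exact haq.trans_le (le_top.trans_eq rfl) |>.trans_le le_top
    · set G := (gaussianArea n (f x₀) s (range f)).toReal with hG
      have hGeq : gaussianArea n (f x₀) s (range f) = ENNReal.ofReal G := (ENNReal.ofReal_toReal htop).symm
      rw [hGeq] at h2 ⊢
      have hG0 : 0 ≤ G := ENNReal.toReal_nonneg
      rw [← ENNReal.ofReal_mul hkpos.le, ← ENNReal.ofReal_add (by positivity) hηpos.le,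
        ENNReal.one_le_ofReal] at h2
      refine haq.trans ((ENNReal.ofReal_lt_ofReal_iff (by nlinarith)).2 ?_)
      -- `q < G` from `1 ≤ k G + η` and `q < (1-η)/k`
      rw [lt_div_iff₀ hkpos] at hηq
      nlinarith
  · -- upper bound
    intro b hb
    -- a real `b'` with `1 < b'` and `ofReal b' ≤ b`
    obtain ⟨b', hb1, hb'⟩ : ∃ b' : ℝ, 1 < b' ∧ ENNReal.ofReal b' ≤ b := by
      by_cases hbt : b = ∞
      · exact ⟨2, one_lt_two, hbt ▸ le_top⟩
      · refine ⟨b.toReal, ?_, (ENNReal.ofReal_toReal hbt).le⟩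
        have := ENNReal.toReal_strict_mono hbt hb
        rwa [ENNReal.toReal_one] at this
    set b₁ : ℝ := (1 + b') / 2 with hb₁
    have hb₁1 : 1 < b₁ := by rw [hb₁]; linarith
    have hb₁b : b₁ < b' := by rw [hb₁]; linarith
    obtain ⟨ε, hε, hε1, hKε⟩ := exists_eps_ratio_pow_lt n hb₁1
    have ha' : 0 < 1 + ε := by linarith
    have hc' : 0 < 1 - ε := by linarith
    obtain ⟨T, hTfd, h, r, hTn, hr, h0, hlip, hco, -, N, hN, hgN⟩ :=
      exists_biLipschitz_tangent_reparam hn hstrict hinj' univ_mem hε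
    haveI := hTfd
    rw [hg0] at h0
    -- `f(V) ⊆ h(ball 0 r)` for the neighbourhood `V = φ.source ∩ φ⁻¹ N` of `x₀`
    set V : Set M := φ.source ∩ φ ⁻¹' N with hV
    have hVn : V ∈ 𝓝 x₀ :=
      inter_mem (extChartAt_source_mem_nhds (I := I) x₀)
        ((continuousAt_extChartAt (I := I) x₀).preimage_mem_nhds hN)
    have hfV : f '' V ⊆ h '' ball (0 : T) r := by
      rintro _ ⟨x, ⟨hxs, hxN⟩, rfl⟩
      have : f x = g (φ x) := by
        simp only [hg, Function.comp_apply, φ.left_inv hxs]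
      rw [this]
      exact hgN ⟨φ x, hxN, rfl⟩
    obtain ⟨δ, hδ, hloc⟩ := exists_ball_inter_range_subset_image hf.continuous hinj hVn
    -- the far part tends to zero
    have hfarlim : Tendsto (fun s : ℝ => ENNReal.ofReal ((4 * Real.pi * s) ^ (-(n : ℝ) / 2) *
        Real.exp (-δ ^ 2 / (4 * s))) * (μHE[n] : Measure F) (range f)) (𝓝[>] 0) (𝓝 0) := by
      have h1 := (ENNReal.tendsto_ofReal (tendsto_farFactor n hδ))
      rw [ENNReal.ofReal_zero] at h1
      have h2 := ENNReal.Tendsto.mul_const h1 (Or.inr hΛ.ne)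
      rwa [zero_mul] at h2
    have hgap : (0 : ℝ≥0∞) < ENNReal.ofReal (b' - b₁) := ENNReal.ofReal_pos.2 (by linarith)
    have hfar_ev : ∀ᶠ s : ℝ in 𝓝[>] 0, ENNReal.ofReal ((4 * Real.pi * s) ^ (-(n : ℝ) / 2) *
        Real.exp (-δ ^ 2 / (4 * s))) * (μHE[n] : Measure F) (range f) < ENNReal.ofReal (b' - b₁) :=
      (tendsto_order.1 hfarlim).2 _ hgap
    filter_upwards [hfar_ev, self_mem_nhdsWithin] with s hsfar hs0
    rw [mem_Ioi] at hs0
    -- split `range f = (range f ∩ ball y₀ δ) ∪ (range f \ ball y₀ δ)`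
    have hsplit : range f = (range f ∩ ball (f x₀) δ) ∪ (range f \ ball (f x₀) δ) := by
      ext y
      constructor
      · intro hy
        by_cases hyb : y ∈ ball (f x₀) δ
        exacts [Or.inl ⟨hy, hyb⟩, Or.inr ⟨hy, hyb⟩]
      · rintro (⟨hy, -⟩ | ⟨hy, -⟩) <;> exact hy
    have hnear : gaussianArea n (f x₀) s (range f ∩ ball (f x₀) δ) ≤ ENNReal.ofReal (((1 + ε) / (1 - ε)) ^ n) := by
      calc gaussianArea n (f x₀) s (range f ∩ ball (f x₀) δ)
          ≤ gaussianArea n (f x₀) s (h '' ball (0 : T) r) := gaussianArea_mono _ _ _ (hloc.trans hfV)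
        _ ≤ ENNReal.ofReal (((1 + ε) / (1 - ε)) ^ n) * gaussianArea n (0 : T) (s / (1 - ε) ^ 2) (ball 0 r) := by
            rw [← h0]
            exact gaussianArea_image_le (n := n) hε hε1 hr hlip hco hs0
        _ ≤ ENNReal.ofReal (((1 + ε) / (1 - ε)) ^ n) * 1 := by
            refine mul_le_mul' le_rfl ?_
            rw [← gaussianArea_zero_univ hTn (by positivity : (0 : ℝ) < s / (1 - ε) ^ 2)]
            exact gaussianArea_mono _ _ _ (subset_univ _)
        _ = ENNReal.ofReal (((1 + ε) / (1 - ε)) ^ n) := mul_one _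
    have hfar : gaussianArea n (f x₀) s (range f \ ball (f x₀) δ) ≤
        ENNReal.ofReal ((4 * Real.pi * s) ^ (-(n : ℝ) / 2) * Real.exp (-δ ^ 2 / (4 * s))) *
          (μHE[n] : Measure F) (range f) := by
      refine (gaussianArea_le_of_le_norm_sub n (f x₀) hs0
        (hK.isClosed.measurableSet.diff measurableSet_ball) hδ.le ?_).trans
        (mul_le_mul' le_rfl (measure_mono fun y hy => hy.1))
      rintro y ⟨-, hyb⟩
      rw [mem_ball_iff_norm, not_lt] at hyb
      exact hyb
    calc gaussianArea n (f x₀) s (range f)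
        = gaussianArea n (f x₀) s ((range f ∩ ball (f x₀) δ) ∪ (range f \ ball (f x₀) δ)) := by
          rw [← hsplit]
      _ ≤ gaussianArea n (f x₀) s (range f ∩ ball (f x₀) δ) +
          gaussianArea n (f x₀) s (range f \ ball (f x₀) δ) := gaussianArea_union_le _ _ _ _ _
      _ ≤ ENNReal.ofReal (((1 + ε) / (1 - ε)) ^ n) +
          ENNReal.ofReal ((4 * Real.pi * s) ^ (-(n : ℝ) / 2) * Real.exp (-δ ^ 2 / (4 * s))) *
            (μHE[n] : Measure F) (range f) := add_le_add hnear hfar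
      _ < ENNReal.ofReal b₁ + ENNReal.ofReal (b' - b₁) :=
          ENNReal.add_lt_add_of_le_of_lt ENNReal.ofReal_ne_top (ENNReal.ofReal_le_ofReal hKε.le) hsfar
      _ = ENNReal.ofReal b' := by
          rw [← ENNReal.ofReal_add (by linarith) (by linarith)]
          congr 1
          ring
      _ ≤ b := hb'

end Limit

end Literature.Geometry.Riemannian

end
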